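import Literature.Probability.LatticeModels.IsingLimitLaw
import Literature.Probability.LatticeModels.LeeYangProofs
import Mathlib.Analysis.Complex.AbsMax
import HarnessLib

/-!
# Discharge of `lee_yang_ising`: the Lee–Yang circle theorem with zero weights allowed

Sibling proof file of `IsingLimitLaw.lean` (which vendors the named fact
`Literature.Probability.LatticeModels.lee_yang_ising`), next to `IsingLimitLawProofs.lean` (GHS)
and `IsingLimitLawPhi4Proofs.lean` (Simon–Griffiths). It proves

* `Literature.Probability.LatticeModels.lee_yang_ising_holds : lee_yang_ising` — for entrywise
  non-negative pair couplings `J` on `Fin n` and weights `wᵢ ≥ 0` (zero weights ALLOWED), the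
  partition function `Z(z) = Σ_s exp(Σ Jᵢⱼ sᵢ sⱼ + z Σ wᵢ sᵢ)` has no zero off the imaginary axis,

from the tree's PROVED open-polydisc Lee–Yang theorem `LeeYangCircle.lyProp_prod_edges`
(`LeeYangProofs.lean`: the multi-affine polynomial `Σ_σ W(σ) ∏_{σₖ = ↓} zₖ` of a product `W` of
ferromagnetic edge factors has no zero with all `|zₖ| < 1`; Lee–Yang 1952, Appendix II, in the
form of Friedli–Velenik 2017, Thm. 3.43 / eq. (3.52); Lieb–Sokal 1981, App. B, Prop. B.1 (a),
eq. (B.5): "nonvanishing if all `|zᵢ| < 1` [this is the Lee–Yang property in the activity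
variables `zᵢ = exp(-2hᵢ)`]").

## What the source says, and what is proved here

Lieb–Sokal 1981, §3 (journal p. 165): a finite measure `μ ≠ 0` on `ℝⁿ` has the *Lee–Yang
property* (Def. 3.1) when its Laplace transform `μ̂` lies in the closure `P̄(Dⁿ)` of the
polynomials non-vanishing on `Dⁿ = {Re hᵢ > 0 ∀ i}`; then `μ̂ ≠ 0` on `Dⁿ`, and (Thm. 3.2,
Cor. 3.3) `exp(Σ Jᵢⱼ φᵢφⱼ) ∏ dνᵢ` has it for `Jᵢⱼ ≥ 0` and spin-½ `νᵢ`. Spins of weight `wᵢ = 0`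
carry the field `hᵢ = z wᵢ = 0`, a BOUNDARY point of `Dⁿ` (activity `ζᵢ = e^{-2hᵢ} = 1` on the unit
circle); the printed route to such points is Hurwitz's theorem (Lieb–Sokal, remark before
Prop. 2.6, p. 161: a limit of polynomials non-vanishing on `A` is `≡ 0` or zero-free on the
interior of `A`), applied to the fields of the weight-zero spins tending to `0`.

Mathlib has no Hurwitz theorem; the boundary points `ζₖ = 1` are reached here instead by an
equivalent finite-dimensional argument, by induction on the set `S` of pinned activities
(`LeeYangCircle.ne_zero_of_pinned`): the polynomial is affine in `ζₖ`,
`P = A(p) + B(p) ζₖ` (`p` = the free activities, in the open unit polydisc `U`); zero-freeness for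
`|ζₖ| < 1` (induction hypothesis) gives `A ≠ 0` and `|B/A| ≤ 1` on `U`; if `P` vanished at
`ζₖ = 1` for some `p₀ ∈ U` then `|B/A|` would attain its maximum `1` at the interior point `p₀`, so
`B/A ≡ -1` on `U` by the **maximum modulus principle** (Mathlib
`Complex.eqOn_of_isPreconnected_of_isMaxOn_norm`, several complex variables), whence `P = 0` at
the point "`1` on `S ∪ {k}`, `0` elsewhere" — impossible, `P` having non-negative coefficients and
constant term `W(all ↑) = 1 > 0` (`LeeYangCircle.sum_prod_edges_ne_zero_of_zero_one`).
The assembly (`lee_yang_circle_theorem_finite_of_nonneg`: fields with `Re hᵢ > 0` OR `hᵢ = 0`;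
then `lee_yang_ising_holds` with `hᵢ = z wᵢ`, `Re z > 0` by the spin flip
`isingFieldPartition_neg`) repeats the factorisation
`Z = (∏ e^{Jᵢⱼ})(∏ e^{hᵢ}) · Σ_σ W(σ) ∏ [σᵢ ? 1 : ζᵢ]` of `lee_yang_circle_theorem_finite_holds`.

## Sources

* T. D. Lee, C. N. Yang, Phys. Rev. 87 (1952) 410–419, Appendix II. [LeeYang1952]
* E. H. Lieb, A. D. Sokal, *A general Lee–Yang theorem for one-component and multicomponent
  ferromagnets*, Comm. Math. Phys. 80 (1981) 153–179: §2, remark before Prop. 2.6 (p. 161);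
  §3, Def. 3.1, Thm. 3.2, Cor. 3.3 (p. 165); App. B, Prop. B.1, eqs. (B.4)–(B.7) (pp. 175–176)
  (read in: E. H. Lieb, *Statistical Mechanics. Selecta*, Springer 2004, pp. 153–179 of the
  reprint). [LiebSokal1981]
* S. Friedli, Y. Velenik, *Statistical Mechanics of Lattice Systems*, CUP 2017, §3.7.4,
  Thm. 3.43, eq. (3.52). [FriedliVelenik2017]
* C. M. Newman, CPAM 27 (1974) 143–159, Thm. 1. [Newman1974]

## Mathlib / tree anchors

`Complex.eqOn_of_isPreconnected_of_isMaxOn_norm`, `Convex.isPreconnected`, `convex_pi`,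
`isOpen_set_pi`, `differentiable_apply`, `Differentiable.fun_sum`, `DifferentiableOn.mul`,
`DifferentiableOn.inv`, `Finset.sum_pos'`; tree: `LeeYangCircle.lyProp_prod_edges`,
`LeeYangCircle.exists_affine_update`, `LeeYangCircle.norm_le_of_forall_ne_zero`
(`LeeYangProofs`), `isingFieldPartition_eq_sum_exp`, `isingFieldPartition_neg` (`IsingLimitLaw`).
This file declares no definition.
-/

noncomputable section

open scoped BigOperators

namespace Literature.Probability.LatticeModels

namespace LeeYangCircle

/-! ### The maximum-modulus step -/

/-- **Pinning an affine family at an interior maximum.** Let `A`, `B` be holomorphic on a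
preconnected open set `U` of a complex normed space with `A(p) + B(p) ζ ≠ 0` for all `p ∈ U`,
`|ζ| < 1`. If `A + B` vanishes at one point of `U` it vanishes at every point of `U`: indeed
`A ≠ 0` and `|B/A| ≤ 1` on `U`, and `B/A = -1` at an interior point forces `B/A ≡ -1` by the
maximum modulus principle. [folklore] -/
theorem affine_pin_eq_zero {E : Type*} [NormedAddCommGroup E] [NormedSpace ℂ E] {U : Set E}
    (hU : IsPreconnected U) (hUo : IsOpen U) {A B : E → ℂ} (hA : DifferentiableOn ℂ A U)
    (hB : DifferentiableOn ℂ B U) (H : ∀ p ∈ U, ∀ ζ : ℂ, ‖ζ‖ < 1 → A p + B p * ζ ≠ 0)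
    {p₀ q : E} (hp₀ : p₀ ∈ U) (hq : q ∈ U) (h0 : A p₀ + B p₀ = 0) : A q + B q = 0 := by
  have hA0 : ∀ p ∈ U, A p ≠ 0 := fun p hp => by simpa using H p hp 0 (by simp)
  have hBA : ∀ p ∈ U, ‖B p‖ ≤ ‖A p‖ := fun p hp => norm_le_of_forall_ne_zero (H p hp)
  set f : E → ℂ := fun p => B p * (A p)⁻¹ with hf
  have hfd : DifferentiableOn ℂ f U := hB.mul (hA.inv hA0)
  have hf1 : ∀ p ∈ U, ‖f p‖ ≤ 1 := fun p hp => by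
    rw [hf]
    dsimp only
    rw [norm_mul, norm_inv, ← div_eq_mul_inv, div_le_one (norm_pos_iff.2 (hA0 p hp))]
    exact hBA p hp
  have hfp₀ : f p₀ = -1 := by
    rw [hf]
    dsimp only
    rw [← div_eq_mul_inv, div_eq_iff (hA0 p₀ hp₀)]
    linear_combination h0
  have hmax : IsMaxOn (norm ∘ f) U p₀ := fun p hp => by
    simpa only [Set.mem_setOf_eq, Function.comp_apply, hfp₀, norm_neg, norm_one] using hf1 p hp
  have key := Complex.eqOn_of_isPreconnected_of_isMaxOn_norm hU hUo hfd hp₀ hmax hq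
  simp only [Function.const_apply, hfp₀] at key
  rw [hf] at key
  dsimp only at key
  rw [← div_eq_mul_inv, div_eq_iff (hA0 q hq)] at key
  linear_combination key

/-- Finite products of differentiable scalar functions are differentiable (general domain).
Elementary. [folklore] -/
theorem differentiable_finset_prod {E : Type*} [NormedAddCommGroup E] [NormedSpace ℂ E]
    {κ : Type*} (s : Finset κ) {F : κ → E → ℂ} (h : ∀ k ∈ s, Differentiable ℂ (F k)) :
    Differentiable ℂ (fun p => ∏ k ∈ s, F k p) := by
  classical
  induction s using Finset.induction_on with
  | empty => simp
  | insert a s ha ih =>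
    simp_rw [Finset.prod_insert ha]
    exact (h a (Finset.mem_insert_self a s)).mul
      (ih fun k hk => h k (Finset.mem_insert_of_mem hk))

/-! ### Pinning activities to `1` -/

variable {ι : Type*} [Fintype ι] [DecidableEq ι]

/-- The multi-affine polynomial `∑_σ W σ ∏ₖ [σ k ? 1 : gₖ(p)]` along differentiable coordinate
maps `gₖ` is differentiable. Elementary. [folklore] -/
theorem differentiable_sum_prod_ite (W : (ι → Bool) → ℂ) {g : ι → (ι → ℂ) → ℂ}
    (hg : ∀ j, Differentiable ℂ (g j)) :
    Differentiable ℂ (fun p : ι → ℂ =>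
      ∑ σ : ι → Bool, W σ * ∏ j, (if σ j then (1 : ℂ) else g j p)) := by
  refine Differentiable.fun_sum fun σ _ => (differentiable_const _).mul ?_
  refine differentiable_finset_prod _ fun j _ => ?_
  by_cases hσ : σ j
  · simp only [hσ, if_true]
    exact differentiable_const _
  · simp only [hσ, Bool.false_eq_true, if_false]
    exact hg j

/-- **Pinning activities to `1`.** If the polynomial `∑_σ W σ ∏ₖ [σ k ? 1 : zₖ]` has no zero in
the open unit polydisc and no zero at the `0/1`-points, then it has no zero at the points with
`zₖ = 1` on any set `S` of coordinates and `|zₖ| < 1` off `S` (induction on `S`; the step is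
`affine_pin_eq_zero` for `P = A(p) + B(p) ζₖ`, `p` the free activities, which would put a zero at
the `0/1`-point "`1` on `S ∪ {k}`, `0` elsewhere"). This replaces the Hurwitz argument of
Lieb–Sokal (remark before Prop. 2.6) for the boundary points `ζₖ = e^{-2hₖ} = 1`, `hₖ = 0`.
[cite: LiebSokal1981, §2, remark before Prop. 2.6 (p. 161); App. B, Prop. B.1 (pp. 175–176)] -/
theorem ne_zero_of_pinned {W : (ι → Bool) → ℂ}
    (hW : ∀ z : ι → ℂ, (∀ j, ‖z j‖ < 1) →
      (∑ σ : ι → Bool, W σ * ∏ j, (if σ j then (1 : ℂ) else z j)) ≠ 0)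
    (h01 : ∀ z : ι → ℂ, (∀ j, z j = 0 ∨ z j = 1) →
      (∑ σ : ι → Bool, W σ * ∏ j, (if σ j then (1 : ℂ) else z j)) ≠ 0)
    (S : Finset ι) :
    ∀ z : ι → ℂ, (∀ j ∈ S, z j = 1) → (∀ j ∉ S, ‖z j‖ < 1) →
      (∑ σ : ι → Bool, W σ * ∏ j, (if σ j then (1 : ℂ) else z j)) ≠ 0 := by
  induction S using Finset.induction_on with
  | empty => exact fun z _ hz => hW z fun j => hz j (Finset.notMem_empty j)
  | insert k S hk ih =>
    intro z hz1 hzlt hzero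
    -- the two coefficients of the affine dependence on the `k`-th activity, as functions of the
    -- free activities `p` (coordinates in `S` pinned to `1`; the values of `p` on `S ∪ {k}` are
    -- ignored)
    set A : (ι → ℂ) → ℂ := fun p => ∑ σ : ι → Bool,
      W σ * ∏ j, (if σ j then (1 : ℂ) else (if j = k then (0 : ℂ) else if j ∈ S then 1 else p j))
      with hA
    set L : (ι → ℂ) → ℂ := fun p => ∑ σ : ι → Bool,
      W σ * ∏ j, (if σ j then (1 : ℂ) else (if j = k then (1 : ℂ) else if j ∈ S then 1 else p j))
      with hL
    have haff : ∀ (p : ι → ℂ) (ζ : ℂ), (∑ σ : ι → Bool,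
        W σ * ∏ j, (if σ j then (1 : ℂ) else (if j = k then ζ else if j ∈ S then 1 else p j))) =
          A p + (L p - A p) * ζ := by
      intro p
      obtain ⟨α, β, hαβ⟩ := exists_affine_update W (fun j => if j ∈ S then (1 : ℂ) else p j) k
      simp only [Function.update_apply] at hαβ
      have e0 := hαβ 0
      have e1 := hαβ 1
      intro ζ
      rw [hαβ ζ, hA, hL]
      dsimp only
      rw [e0, e1]
      ring
    -- the free region: open polydisc in the coordinates off `S ∪ {k}`
    set U : Set (ι → ℂ) := ((↑(insert k S) : Set ι)ᶜ).pi fun _ => Metric.ball (0 : ℂ) 1 with hU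
    have hmemU : ∀ p : ι → ℂ, p ∈ U ↔ ∀ j, j ∉ insert k S → ‖p j‖ < 1 := fun p => by
      simp only [hU, Set.mem_pi, Set.mem_compl_iff, Finset.mem_coe, mem_ball_zero_iff]
    have hUo : IsOpen U := isOpen_set_pi (Set.toFinite _) fun _ _ => Metric.isOpen_ball
    have hUc : IsPreconnected U :=
      (convex_pi fun _ _ => convex_ball (0 : ℂ) 1).isPreconnected
    -- zero-freeness for `|ζ| < 1` on `U`, from the induction hypothesis
    have H : ∀ p ∈ U, ∀ ζ : ℂ, ‖ζ‖ < 1 → A p + (L p - A p) * ζ ≠ 0 := by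
      intro p hp ζ hζ
      rw [← haff]
      rw [hmemU] at hp
      refine ih (fun j => if j = k then ζ else if j ∈ S then 1 else p j) ?_ ?_
      · intro j hj
        have hjk : j ≠ k := fun h => hk (h ▸ hj)
        simp only [hjk, if_false, hj, if_true]
      · intro j hj
        by_cases hjk : j = k
        · simp only [hjk, if_true]
          exact hζ
        · have hj' : j ∉ insert k S := by simp [hjk, hj]
          simp only [hjk, if_false, hj]
          exact hp j hj'
    -- differentiability of the coefficients
    have hAd : Differentiable ℂ A :=
      differentiable_sum_prod_ite W
        (g := fun j p => if j = k then (0 : ℂ) else if j ∈ S then 1 else p j) fun j => by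
          by_cases hjk : j = k
          · simp only [hjk, if_true]
            exact differentiable_const _
          · by_cases hjS : j ∈ S
            · simp only [hjk, if_false, hjS, if_true]
              exact differentiable_const _
            · simp only [hjk, if_false, hjS]
              exact differentiable_apply j
    have hLd : Differentiable ℂ L :=
      differentiable_sum_prod_ite W
        (g := fun j p => if j = k then (1 : ℂ) else if j ∈ S then 1 else p j) fun j => by
          by_cases hjk : j = k
          · simp only [hjk, if_true]
            exact differentiable_const _
          · by_cases hjS : j ∈ S
            · simp only [hjk, if_false, hjS, if_true]
              exact differentiable_const _
            · simp only [hjk, if_false, hjS]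
              exact differentiable_apply j
    -- `z` itself is a free point, and there `A + B = L z = P(z) = 0`
    have hzU : z ∈ U := (hmemU z).2 fun j hj => hzlt j hj
    have h0U : (0 : ι → ℂ) ∈ U := (hmemU 0).2 fun j _ => by simp
    have hLz : L z = 0 := by
      rw [← hzero, hL]
      dsimp only
      refine Finset.sum_congr rfl fun σ _ => ?_
      congr 1
      refine Finset.prod_congr rfl fun j _ => ?_
      by_cases hjk : j = k
      · rw [if_pos hjk, hjk, hz1 k (Finset.mem_insert_self k S)]
      · rw [if_neg hjk]
        by_cases hjS : j ∈ S
        · rw [if_pos hjS, hz1 j (Finset.mem_insert_of_mem hjS)]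
        · rw [if_neg hjS]
    have hBd : DifferentiableOn ℂ (fun p => L p - A p) U := (hLd.sub hAd).differentiableOn
    have hz0 : A z + (L z - A z) = 0 := by rw [hLz]; ring
    have hpin := affine_pin_eq_zero (B := fun p => L p - A p) hUc hUo hAd.differentiableOn hBd H
      hzU h0U hz0
    -- so `P` vanishes at the `0/1`-point "`1` on `S ∪ {k}`, `0` elsewhere": contradiction
    have hL0 : L 0 = 0 := by linear_combination hpin
    refine h01 (fun j => if j = k then (1 : ℂ) else if j ∈ S then 1 else 0) (fun j => ?_) ?_
    · by_cases hjk : j = k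
      · simp [hjk]
      · by_cases hjS : j ∈ S <;> simp [hjk, hjS]
    · convert hL0 using 1
      simp only [hL, Pi.zero_apply]

/-- At a `0/1`-point the polynomial of a product of ferromagnetic edge factors
`[σᵢ = σⱼ ? 1 : tᵢⱼ]`, `tᵢⱼ ≥ 0`, is a sum of non-negative reals containing the term `1` of the
all-`↑` configuration, hence non-zero. Elementary. [folklore] -/
theorem sum_prod_edges_ne_zero_of_zero_one (t : ι → ι → ℝ) (ht0 : ∀ i j, 0 ≤ t i j)
    (s : Finset (ι × ι)) (z : ι → ℂ) (hz : ∀ j, z j = 0 ∨ z j = 1) :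
    (∑ σ : ι → Bool, (∏ p ∈ s, (if σ p.1 = σ p.2 then 1 else (t p.1 p.2 : ℂ))) *
        ∏ j, (if σ j then (1 : ℂ) else z j)) ≠ 0 := by
  obtain ⟨x, hx0, rfl⟩ : ∃ x : ι → ℝ, (∀ j, 0 ≤ x j) ∧ z = fun j => (x j : ℂ) := by
    refine ⟨fun j => if z j = 0 then 0 else 1, fun j => ?_, funext fun j => ?_⟩
    · dsimp only
      split_ifs <;> norm_num
    · rcases hz j with h | h <;> simp [h]
  have hreal : (∑ σ : ι → Bool, (∏ p ∈ s, (if σ p.1 = σ p.2 then 1 else (t p.1 p.2 : ℂ))) *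
      ∏ j, (if σ j then (1 : ℂ) else ((x j : ℝ) : ℂ))) =
        ((∑ σ : ι → Bool, (∏ p ∈ s, (if σ p.1 = σ p.2 then 1 else t p.1 p.2)) *
          ∏ j, (if σ j then (1 : ℝ) else x j) : ℝ) : ℂ) := by
    push_cast
    refine Finset.sum_congr rfl fun σ _ => ?_
    congr 1
    · refine Finset.prod_congr rfl fun p _ => ?_
      split_ifs <;> simp
    · refine Finset.prod_congr rfl fun j _ => ?_
      split_ifs <;> simp
  rw [hreal, Complex.ofReal_ne_zero]
  refine (Finset.sum_pos' (fun σ _ => mul_nonneg (Finset.prod_nonneg fun p _ => ?_)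
    (Finset.prod_nonneg fun j _ => ?_)) ⟨fun _ => true, Finset.mem_univ _, by simp⟩).ne'
  · split_ifs
    exacts [zero_le_one, ht0 _ _]
  · split_ifs
    exacts [zero_le_one, hx0 j]

end LeeYangCircle

/-! ### Fields in the open right half plane or equal to zero -/

open LeeYangCircle in
/-- **Lee–Yang circle theorem, fields `Re hᵢ > 0` or `hᵢ = 0`.** For `n` spins, couplings
`J i j ≥ 0` and complex fields each of which either has `0 < Re (h i)` or vanishes,
`∑_{σ : Fin n → Bool} exp (∑ᵢ ∑ⱼ Jᵢⱼ [σᵢ = σⱼ ? 1 : −1] + ∑ᵢ hᵢ [σᵢ ? 1 : −1]) ≠ 0`: the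
activities `ζᵢ = e^{-2hᵢ}` lie in the open unit disc or equal `1`, and the factorisation
`Z = (∏ e^{Jᵢⱼ})(∏ e^{hᵢ}) Σ_σ W(σ) ∏ [σᵢ ? 1 : ζᵢ]` of `lee_yang_circle_theorem_finite_holds`
reduces to `ne_zero_of_pinned` over `lyProp_prod_edges`. (Lieb–Sokal: the spin-½ ferromagnetic
measure has the Lee–Yang property, Cor. 3.3 with Def. 3.1, and boundary fields `hᵢ = 0` are
reached by Hurwitz, remark before Prop. 2.6; here by the maximum modulus principle.)
[cite: LeeYang1952, Appendix II] [cite: LiebSokal1981, §3, Def. 3.1, Thm. 3.2, Cor. 3.3 (p. 165)]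
[cite: FriedliVelenik2017, Thm 3.43, eq. (3.52)] -/
theorem lee_yang_circle_theorem_finite_of_nonneg {n : ℕ} (J : Fin n → Fin n → ℝ)
    (h : Fin n → ℂ) (hJ : ∀ i j, 0 ≤ J i j) (hh : ∀ i, 0 < (h i).re ∨ h i = 0) :
    (∑ σ : Fin n → Bool, Complex.exp ((∑ i, ∑ j, ((J i j : ℂ) * (if σ i = σ j then 1 else -1))) +
      ∑ i, h i * (if σ i then 1 else -1))) ≠ 0 := by
  classical
  -- activities, edge parameters, pinned set
  set z : Fin n → ℂ := fun i => Complex.exp (-2 * h i) with hz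
  set t : Fin n → Fin n → ℝ := fun i j => Real.exp (-2 * J i j) with ht
  set S : Finset (Fin n) := Finset.univ.filter fun i => h i = 0 with hS
  have hzS : ∀ i ∈ S, z i = 1 := by
    intro i hi
    rw [hS, Finset.mem_filter] at hi
    rw [hz]
    simp [hi.2]
  have hzlt : ∀ i ∉ S, ‖z i‖ < 1 := by
    intro i hi
    have hre : 0 < (h i).re := by
      rcases hh i with h' | h'
      · exact h'
      · exfalso
        apply hi
        rw [hS]
        exact Finset.mem_filter.2 ⟨Finset.mem_univ i, h'⟩
    rw [hz]
    simp only [Complex.norm_exp]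
    rw [Real.exp_lt_one_iff]
    simp only [Complex.mul_re, Complex.neg_re, Complex.neg_im, Complex.re_ofNat, Complex.im_ofNat]
    nlinarith
  have ht0 : ∀ i j, 0 ≤ t i j := fun i j => (Real.exp_pos _).le
  have ht1 : ∀ i j, t i j ≤ 1 := fun i j => by
    rw [ht]; simp only [Real.exp_le_one_iff]; nlinarith [hJ i j]
  have hLY := ne_zero_of_pinned (lyProp_prod_edges t ht0 ht1 Finset.univ)
    (sum_prod_edges_ne_zero_of_zero_one t ht0 Finset.univ) S z hzS hzlt
  -- per-configuration factorisation of the Boltzmann weight (as in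
  -- `lee_yang_circle_theorem_finite_holds`)
  have hterm : ∀ σ : Fin n → Bool,
      Complex.exp ((∑ i, ∑ j, ((J i j : ℂ) * (if σ i = σ j then 1 else -1))) +
        ∑ i, h i * (if σ i then 1 else -1)) =
      ((∏ i, ∏ j, Complex.exp (J i j)) * ∏ i, Complex.exp (h i)) *
        ((∏ p : Fin n × Fin n, (if σ p.1 = σ p.2 then 1 else (t p.1 p.2 : ℂ))) *
          ∏ i, (if σ i then 1 else z i)) := by
    intro σ
    rw [Complex.exp_add, Complex.exp_sum, Complex.exp_sum, Fintype.prod_prod_type]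
    simp_rw [Complex.exp_sum]
    have eJ : ∀ i j, Complex.exp ((J i j : ℂ) * (if σ i = σ j then 1 else -1)) =
        Complex.exp (J i j) * (if σ i = σ j then 1 else (t i j : ℂ)) := by
      intro i j
      split_ifs with hs
      · simp
      · rw [ht]
        simp only [Complex.ofReal_exp, ← Complex.exp_add]
        congr 1
        push_cast
        ring
    have eh : ∀ i, Complex.exp (h i * (if σ i then 1 else -1)) =
        Complex.exp (h i) * (if σ i then 1 else z i) := by
      intro i
      split_ifs with hs
      · simp
      · rw [hz, ← Complex.exp_add]
        congr 1
        ring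
    simp_rw [eJ, eh, Finset.prod_mul_distrib]
    ring
  simp_rw [hterm]
  rw [← Finset.mul_sum]
  refine mul_ne_zero (mul_ne_zero ?_ ?_) ?_
  · exact Finset.prod_ne_zero_iff.mpr fun i _ =>
      Finset.prod_ne_zero_iff.mpr fun j _ => Complex.exp_ne_zero _
  · exact Finset.prod_ne_zero_iff.mpr fun i _ => Complex.exp_ne_zero _
  · exact hLY

/-! ### Discharge of `lee_yang_ising` -/

/-- **Discharge of the named fact `lee_yang_ising`** (Lee–Yang circle theorem, partition-function
form, non-negative weights with zero weights allowed): for entrywise non-negative pair couplings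
`J` and weights `wᵢ ≥ 0`, `Z(z) = Σ_s exp(Σ Jᵢⱼ sᵢ sⱼ + z Σ wᵢ sᵢ) ≠ 0` whenever `Re z ≠ 0`.
Proof: `Re z > 0` by the spin flip `Z(-z) = Z(z)` (`isingFieldPartition_neg`); then the fields
`hᵢ = z wᵢ` have `Re hᵢ = wᵢ Re z > 0` when `wᵢ > 0` and `hᵢ = 0` when `wᵢ = 0`, and
`lee_yang_circle_theorem_finite_of_nonneg` applies (open-polydisc Lee–Yang by Asano contractions,
`lyProp_prod_edges`, plus pinning of the unit activities by the maximum modulus principle in place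
of Lieb–Sokal's Hurwitz argument).
[cite: LiebSokal1981, §3, Def. 3.1, Thm. 3.2, Cor. 3.3 (p. 165); §2, remark before Prop. 2.6 (p. 161)]
[cite: LeeYang1952, Appendix II] [cite: Newman1974, Thm. 1] -/
theorem lee_yang_ising_holds : lee_yang_ising := by
  intro n J w hJ hw z hz
  wlog hpos : 0 < z.re generalizing z
  · have hneg : 0 < (-z).re := by
      rw [Complex.neg_re]
      rcases lt_or_gt_of_ne hz with hlt | hgt
      · linarith
      · exact absurd hgt hpos
    rw [← isingFieldPartition_neg]
    exact this (-z) (by rw [Complex.neg_re]; exact neg_ne_zero.2 hz) hneg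
  rw [isingFieldPartition_eq_sum_exp]
  exact lee_yang_circle_theorem_finite_of_nonneg J (fun i => z * w i) hJ fun i => by
    rcases (hw i).lt_or_eq with hlt | heq
    · left
      rw [Complex.re_mul_ofReal]
      exact mul_pos hpos hlt
    · right
      simp [← heq]

end Literature.Probability.LatticeModels

end
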